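import Summits.KontsevichZagierPeriods.KontsevichZagierPeriods.Theorems.HurwitzMicroSectorsNormalFormPrincipleLevelOneReduction
import Summits.KontsevichZagierPeriods.KontsevichZagierPeriods.Theorems.HurwitzMicroSectorsNormalFormPrincipleSplitMoves
import Summits.KontsevichZagierPeriods.KontsevichZagierPeriods.Theorems.HurwitzMicroSectorsNormalFormPrincipleDlogMoves
import Summits.KontsevichZagierPeriods.KontsevichZagierPeriods.Theorems.HurwitzMicroSectorsNormalFormPrincipleLevelNExistsRep
import Summits.KontsevichZagierPeriods.KontsevichZagierPeriods.Theorems.HurwitzMicroSectorsNormalFormPrincipleLevelNExistsTriangleRep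
import Summits.KontsevichZagierPeriods.KontsevichZagierPeriods.Theorems.HurwitzMicroSectorsNormalFormPrincipleLevelNMergeBoxSubTriangle
import Summits.KontsevichZagierPeriods.KontsevichZagierPeriods.Theorems.HurwitzMicroSectorsNormalFormPrincipleLevelNTriangleSubDimOne
import Summits.KontsevichZagierPeriods.KontsevichZagierPeriods.Theorems.HurwitzMicroSectorsNormalFormPrincipleLevelNValueLevelTwoRep
import Summits.KontsevichZagierPeriods.KontsevichZagierPeriods.Theorems.HurwitzMicroSectorsNormalFormPrincipleLevelNDiagOddLevelTwo
import Summits.KontsevichZagierPeriods.KontsevichZagierPeriods.Theorems.HurwitzMicroSectorsNormalFormPrincipleLevelNDimOneLevelTwoReduce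
import Literature.NumberTheory.Transcendental.BoxIntegralZetaValues
import Literature.NumberTheory.Transcendental.KZLogCalculusProofs
import Literature.NumberTheory.Transcendental.KZProductIdeal

/-!
# `NormalFormPrinciple` (stmt-KontsevichZagierPeriods-3869), line `SketchIdeator1` — the leaf
# `stub_boxRigidity` in dimension two, LEVEL TWO, I: the REDUCTION of `[(0,1)², P(x,y)/(1 − x²y²)]`

Pure proof file (lead seat c7, wave 3; `--supports` the crux; registered sub-goal `levelTwo_reduce`; the
rigidity half is the companion file `…LevelTwo.lean`). After level one (`…LevelOne.lean`,
unconditional) the next rung of Kontsevich–Zagier's box family: all `[(0,1)², P/(1 − x₀²x₁²)]`,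
`P ∈ ℚ[x₀,x₁]`, whose values fill `ℚ + ℚπ² + ℚ log 2` (`∫∫ dxdy/(1−x²y²) = Σ 1/(2k+1)² = π²/8`,
`∫∫ x dxdy/(1−x²y²) = ½ log 2`). THREE ENGINES MEET:

* the MERGE GADGET at level `N` (`merge_box_sub_triangle_levelN`, `triangle_sub_dimOne_levelN`, stated
  for every `N ≥ 1`): an off-diagonal monomial `c x₀^a x₁^b/(1 − (x₀x₁)^N)`, `a > b`, becomes the
  dimension-ONE representation `[(0,1), (c/(a−b)) s^b (Σ_{i<a−b} sⁱ)/(Σ_{i<N} sⁱ)]` — a box-rational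
  representation with a cyclotomic denominator, the input format of the dimension-one layers;
* at level two `Σ_{i<2} sⁱ = 1 + s` and `[(0,1), p(s)/(1+s)] ≡ γ[(1,2), 1/y] + [pt, a]` by one affine
  move into the DLOG family of seat c3 (`dimOne_levelTwo_reduce`);
* the route's DILATION MOVE (closed crux 3872): `3[(0,1)², t/(1−t²)] ≡ [(0,1)², 1/(1−t²)]`
  (`diagOdd_levelTwo_sub_mem_relations`), so the diagonal has ONE carrier.

Results: `levelTwo_reduce` — normal form `β[(0,1)², 1/(1−x₀²x₁²)] + γ[(1,2), 1/y] + [pt, q]`;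
`levelTwo_value` — value `β·π²/8 + γ·log 2 + q`; `boxRigidity_levelTwo_dim_two` — **Conjecture 1 on the
level-two family ⟸ `LinearIndependent ℚ ![1, π², log 2]`** (open; Schanuel-implied); and the JOINT
statement with level one (`levelOneRep_sub_levelTwoRep_mem_relations`: `[β/(1−xy)] ≡ [(4β/3)/(1−x²y²)]`,
Euler's `ζ(2) = (4/3)Σ1/(2k+1)²` inside the calculus; `boxRigidity_levelOne_levelTwo`).
Sources: M. Kontsevich, D. Zagier, *Periods* (2001), §1.2 Conjecture 1, rules (1)–(3).
No definitions are introduced.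
-/

noncomputable section

open MeasureTheory Set
open scoped Polynomial
open Literature.NumberTheory.Transcendental Literature.NumberTheory.Transcendental.KZ
open Literature.ModelTheory.ExponentialFields (IsSemialgebraic)

namespace Summit.KontsevichZagierPeriods.HurwitzMicroSectors.NormalFormPrinciple.PiBox.LevelN

open Summit.KontsevichZagierPeriods.HurwitzMicroSectors.NormalFormPrinciple.PiBox.Dlog
  (exists_ptCarrier value_pt pt_add_mem_relations pt_zero_mem_relations pt_congr_mem_relations
   exists_dlog value_dlog dlog_congr_mem_relations dlog_zero_mem_relations dlog_merge_mem_relations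
   exists_rep_unit)
open Summit.KontsevichZagierPeriods.HurwitzMicroSectors.NormalFormPrinciple.PiBox.LevelOne
  (exists_boxPolyRep boxPoly_exists_pt aeval_monomial_two diag_identity one_sub_mul_pos_of_mem_box)

/-! ## Composition (lead): level two in full -/

/-! ### The symmetry `x₀ ↔ x₁` at level `N` -/

/-- **Coordinate swap at level `N`** (rule 2). [cite: KontsevichZagier2001, §1.2 rule (2)] -/
theorem swap_monomial_levelN (Nl : ℕ) (a b : ℕ) (c : ℚ) (N N' : IntegralRep 2)
    (hNd : N.domain = {x | ∀ i, x i ∈ Set.Ioo (0:ℝ) 1})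
    (hNi : EqOn N.integrand (fun x => (c : ℝ) * (x 0 ^ a * x 1 ^ b) / (1 - (x 0 * x 1) ^ Nl)) N.domain)
    (hN'd : N'.domain = {x | ∀ i, x i ∈ Set.Ioo (0:ℝ) 1})
    (hN'i : EqOn N'.integrand (fun x => (c : ℝ) * (x 0 ^ b * x 1 ^ a) / (1 - (x 0 * x 1) ^ Nl)) N'.domain) :
    of N - of N' ∈ relations := by
  have h1 := of_sub_of_reindex_mem_relations N (Equiv.swap (0 : Fin 2) 1)
  have hd : (N.reindex (Equiv.swap (0 : Fin 2) 1)).domain = {x | ∀ i, x i ∈ Set.Ioo (0:ℝ) 1} := by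
    ext w
    simp only [IntegralRep.reindex_domain, hNd, mem_setOf_eq, Fin.forall_fin_two,
      Equiv.swap_apply_left, Equiv.swap_apply_right]
    tauto
  have h2 : of (N.reindex (Equiv.swap (0 : Fin 2) 1)) - of N' ∈ relations := by
    refine of_sub_of_mem_relations_of_eqOn (hN'd.trans hd.symm) fun w hw => ?_
    have hw' : (fun i => w (Equiv.swap (0 : Fin 2) 1 i)) ∈ N.domain := by
      rw [IntegralRep.reindex_domain] at hw
      exact hw
    rw [IntegralRep.reindex_integrand]
    show N.integrand (fun i => w (Equiv.swap (0 : Fin 2) 1 i)) = N'.integrand w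
    rw [hNi hw', hN'i (hN'd ▸ hd ▸ hw)]
    simp only [Equiv.swap_apply_left, Equiv.swap_apply_right]
    ring
  have e : of N - of N' = (of N - of (N.reindex (Equiv.swap (0 : Fin 2) 1))) +
      (of (N.reindex (Equiv.swap (0 : Fin 2) 1)) - of N') := by abel
  rw [e]
  exact relations.add_mem h1 h2

/-! ### Off-diagonal monomials at level two leave `[(0,1), p(s)/(1 + s)]` -/

/-- **An off-diagonal level-two monomial (`a > b`) is congruent to a dimension-one representation
`[(0,1), p₁(s)/(1 + s)]`** (merge gadget at level 2 + Newton–Leibniz; `Σ_{i<2} sⁱ = 1 + s`).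
[cite: KontsevichZagier2001, §1.2] -/
theorem offDiag_levelTwo_of_lt (a b : ℕ) (c : ℚ) (hab : b < a) (N : IntegralRep 2)
    (hNd : N.domain = {x | ∀ i, x i ∈ Set.Ioo (0:ℝ) 1})
    (hNi : EqOn N.integrand (fun x => (c : ℝ) * (x 0 ^ a * x 1 ^ b) / (1 - (x 0 * x 1) ^ 2)) N.domain) :
    ∃ (p₁ : MvPolynomial (Fin 1) ℚ) (N₁ : IntegralRep 1),
      N₁.domain = {x | ∀ i, x i ∈ Set.Ioo (0:ℝ) 1} ∧
      EqOn N₁.integrand (fun x => (MvPolynomial.aeval x p₁ : ℝ) / (1 + x 0)) N₁.domain ∧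
      of N - of N₁ ∈ relations := by
  obtain ⟨R, hRd, hRi⟩ := exists_triangleRep_levelN 2 (by norm_num) a b c hab
  have h1 := merge_box_sub_triangle_levelN 2 (by norm_num) a b c hab N R hNd hNi hRd
    (by rw [hRi]; exact fun _ _ => rfl)
  -- the dimension-one representation `[(0,1), P(s)/(1+s)]`
  set P : ℚ[X] := Polynomial.C (c / ((a - b : ℕ) : ℚ)) *
    (Polynomial.X ^ b * ∑ i ∈ Finset.range (a - b), Polynomial.X ^ i) with hP
  obtain ⟨N₁, hN₁d, hN₁i⟩ := exists_rep_unit P (Polynomial.X + 1) (fun t ht => by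
    have : (0:ℝ) ≤ t := ht.1
    simp only [Polynomial.aeval_add, Polynomial.aeval_X, Polynomial.aeval_one]
    linarith)
  have hN₁d' : N₁.domain = {x | ∀ i, x i ∈ Set.Ioo (0:ℝ) 1} := by
    rw [hN₁d, Unicoord.box_one_eq]
  have hPev : ∀ x : Fin 1 → ℝ, (Polynomial.aeval (x 0) P : ℝ) =
      (c : ℝ) / ((a - b : ℕ) : ℝ) * (x 0 ^ b * ∑ i ∈ Finset.range (a - b), x 0 ^ i) := fun x => by
    rw [hP]
    simp [Polynomial.aeval_mul, map_sum]
  have h2 := triangle_sub_dimOne_levelN 2 (by norm_num) a b c hab R N₁ hRd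
    (by rw [hRi]; exact fun _ _ => rfl) hN₁d' (fun x _ => by
      rw [hN₁i]
      dsimp only
      rw [Finset.sum_range_succ, Finset.sum_range_one, hPev]
      simp only [Polynomial.aeval_add, Polynomial.aeval_X, Polynomial.aeval_one, pow_one]
      ring)
  set p₁ : MvPolynomial (Fin 1) ℚ := MvPolynomial.C (c / ((a - b : ℕ) : ℚ)) *
    (MvPolynomial.X 0 ^ b * ∑ i ∈ Finset.range (a - b), MvPolynomial.X 0 ^ i) with hp₁
  refine ⟨p₁, N₁, hN₁d', fun x _ => ?_, ?_⟩
  · rw [hN₁i]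
    simp only [Polynomial.aeval_add, Polynomial.aeval_X, Polynomial.aeval_one, hPev, hp₁]
    simp [map_sum, add_comm]
  · have e : of N - of N₁ = (of N - of R) + (of R - of N₁) := by abel
    rw [e]
    exact relations.add_mem h1 h2

/-- **Every off-diagonal level-two monomial reduces to `γ[(1,2), 1/y] + [pt, a]`**
(`offDiag_levelTwo_of_lt` after the symmetry if `a < b`, then `dimOne_levelTwo_reduce`).
[cite: KontsevichZagier2001, §1.2] -/
theorem offDiag_levelTwo (a b : ℕ) (c : ℚ) (hab : a ≠ b) (N : IntegralRep 2)
    (hNd : N.domain = {x | ∀ i, x i ∈ Set.Ioo (0:ℝ) 1})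
    (hNi : EqOn N.integrand (fun x => (c : ℝ) * (x 0 ^ a * x 1 ^ b) / (1 - (x 0 * x 1) ^ 2)) N.domain) :
    ∃ γ q : ℚ, ∀ (L : IntegralRep 1) (Z : IntegralRep 0),
      L.domain = {x | x 0 ∈ Set.Ioo (1:ℝ) 2} → EqOn L.integrand (fun x => (γ : ℝ) / x 0) L.domain →
      Z.domain = Set.univ → (Z.integrand = fun _ => (q : ℝ)) →
      of N - of L - of Z ∈ relations := by
  -- first reduce to `a > b`
  have key : ∀ (a b : ℕ) (N : IntegralRep 2), b < a → N.domain = {x | ∀ i, x i ∈ Set.Ioo (0:ℝ) 1} →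
      EqOn N.integrand (fun x => (c : ℝ) * (x 0 ^ a * x 1 ^ b) / (1 - (x 0 * x 1) ^ 2)) N.domain →
      ∃ γ q : ℚ, ∀ (L : IntegralRep 1) (Z : IntegralRep 0),
        L.domain = {x | x 0 ∈ Set.Ioo (1:ℝ) 2} → EqOn L.integrand (fun x => (γ : ℝ) / x 0) L.domain →
        Z.domain = Set.univ → (Z.integrand = fun _ => (q : ℝ)) →
        of N - of L - of Z ∈ relations := by
    intro a b N hab hNd hNi
    obtain ⟨p₁, N₁, hN₁d, hN₁i, h1⟩ := offDiag_levelTwo_of_lt a b c hab N hNd hNi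
    obtain ⟨γ, q, h2⟩ := dimOne_levelTwo_reduce p₁ N₁ hN₁d hN₁i
    refine ⟨γ, q, fun L Z hLd hLi hZd hZi => ?_⟩
    have e : of N - of L - of Z = (of N - of N₁) + (of N₁ - of L - of Z) := by abel
    rw [e]
    exact relations.add_mem h1 (h2 L Z hLd hLi hZd hZi)
  rcases lt_or_gt_of_ne hab with h | h
  · let s : Fin 2 →₀ ℕ := Finsupp.single 0 b + Finsupp.single 1 a
    obtain ⟨N', hN'd, hN'i⟩ := exists_levelNRep 2 (by norm_num) (MvPolynomial.monomial s c)
    have hN'i' : EqOn N'.integrand (fun x => (c : ℝ) * (x 0 ^ b * x 1 ^ a) / (1 - (x 0 * x 1) ^ 2))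
        N'.domain := fun x _ => by
      rw [hN'i]
      show (MvPolynomial.aeval x (MvPolynomial.monomial s c) : ℝ) / (1 - (x 0 * x 1) ^ 2) = _
      rw [aeval_monomial_two]
      simp [s]
    have h1 := swap_monomial_levelN 2 a b c N N' hNd hNi hN'd hN'i'
    obtain ⟨γ, q, h2⟩ := key b a N' h hN'd hN'i'
    refine ⟨γ, q, fun L Z hLd hLi hZd hZi => ?_⟩
    have e : of N - of L - of Z = (of N - of N') + (of N' - of L - of Z) := by abel
    rw [e]
    exact relations.add_mem h1 (h2 L Z hLd hLi hZd hZi)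
  · exact key a b N h hNd hNi

/-! ### Diagonal monomials at level two -/

/-- **A diagonal level-two monomial `c tᵃ/(1 − t²)` is `β[(0,1)², 1/(1−t²)] + [pt, q]`** (`t = x₀x₁`):
`t^{2m}/(1−t²) = 1/(1−t²) − Σ_{i<m} t^{2i}` and `t^{2m+1}/(1−t²) = t/(1−t²) − Σ_{i<m} t^{2i+1}`
(rule 1b), the odd carrier being `(c/3)[1/(1−t²)]` by the dilation (`diagOdd_levelTwo_sub_mem_relations`).
[cite: KontsevichZagier2001, §1.2] -/
theorem diag_levelTwo (a : ℕ) (c : ℚ) (N : IntegralRep 2)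
    (hNd : N.domain = {x | ∀ i, x i ∈ Set.Ioo (0:ℝ) 1})
    (hNi : EqOn N.integrand (fun x => (c : ℝ) * (x 0 ^ a * x 1 ^ a) / (1 - (x 0 * x 1) ^ 2)) N.domain) :
    ∃ β q : ℚ, ∀ (B : IntegralRep 2) (Z : IntegralRep 0),
      B.domain = {x | ∀ i, x i ∈ Set.Ioo (0:ℝ) 1} →
      EqOn B.integrand (fun x => (β : ℝ) / (1 - (x 0 * x 1) ^ 2)) B.domain →
      Z.domain = Set.univ → (Z.integrand = fun _ => (q : ℝ)) →
      of N - of B - of Z ∈ relations := by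
  obtain ⟨m, rfl | rfl⟩ := Nat.even_or_odd' a
  · -- `a = 2m`: `c t^{2m}/(1−t²) = c/(1−t²) − c Σ_{i<m} (t²)^i`
    set pQ : MvPolynomial (Fin 2) ℚ :=
      -(MvPolynomial.C c * ∑ i ∈ Finset.range m, ((MvPolynomial.X 0 * MvPolynomial.X 1) ^ 2) ^ i)
      with hpQ
    obtain ⟨Q, hQd, hQi⟩ := exists_boxPolyRep pQ
    obtain ⟨q, hq⟩ := boxPoly_exists_pt pQ Q hQd hQi
    refine ⟨c, q, fun B Z hBd hBi hZd hZi => ?_⟩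
    have hadd : of N - of B - of Q ∈ relations := by
      refine integrandAddRel_subset_relations ⟨2, N, B, Q, hBd.trans hNd.symm, hQd.trans hNd.symm,
        fun x hx => ?_, rfl⟩
      have hxB : x ∈ B.domain := by rw [hBd, ← hNd]; exact hx
      have hxQ : x ∈ Q.domain := by rw [hQd, ← hNd]; exact hx
      have hx' : ∀ i, x i ∈ Set.Ioo (0:ℝ) 1 := by rw [hNd] at hx; exact hx
      have ht : 1 - (x 0 * x 1) ^ 2 ≠ 0 := by
        have h0 := hx' 0; have h1 := hx' 1
        have hp : 0 < x 0 * x 1 := mul_pos h0.1 h1.1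
        have hlt : x 0 * x 1 < 1 := by nlinarith [h0.1, h0.2, h1.1, h1.2]
        have hsq : (x 0 * x 1) ^ 2 < 1 := by nlinarith
        exact (sub_pos.2 hsq).ne'
      rw [Pi.add_apply, hNi hx, hBi hxB, hQi hxQ, hpQ]
      simp only [map_neg, map_mul, MvPolynomial.aeval_C, map_sum, map_pow, MvPolynomial.aeval_X,
        eq_ratCast]
      have e1 : x 0 ^ (2 * m) * x 1 ^ (2 * m) = ((x 0 * x 1) ^ 2) ^ m := by ring
      rw [e1]
      exact diag_identity c ((x 0 * x 1) ^ 2) m ht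
    have e : of N - of B - of Z = (of N - of B - of Q) + (of Q - of Z) := by abel
    rw [e]
    exact relations.add_mem hadd (hq Z hZd hZi)
  · -- `a = 2m+1`: `c t^{2m+1}/(1−t²) = c t/(1−t²) − c Σ_{i<m} t (t²)^i`, then the dilation
    set pQ : MvPolynomial (Fin 2) ℚ :=
      -(MvPolynomial.C c * ∑ i ∈ Finset.range m,
        (MvPolynomial.X 0 * MvPolynomial.X 1) * ((MvPolynomial.X 0 * MvPolynomial.X 1) ^ 2) ^ i)
      with hpQ
    obtain ⟨Q, hQd, hQi⟩ := exists_boxPolyRep pQ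
    obtain ⟨q, hq⟩ := boxPoly_exists_pt pQ Q hQd hQi
    -- the odd carrier `S = [box, c t/(1−t²)]`
    obtain ⟨S, hSd, hSi⟩ := exists_levelNRep 2 (by norm_num)
      (MvPolynomial.C c * (MvPolynomial.X 0 * MvPolynomial.X 1))
    have hSi' : EqOn S.integrand (fun x => (c : ℝ) * (x 0 * x 1) / (1 - (x 0 * x 1) ^ 2)) S.domain :=
      fun x _ => by rw [hSi]; simp
    refine ⟨c / 3, q, fun B Z hBd hBi hZd hZi => ?_⟩
    have hadd : of N - of S - of Q ∈ relations := by
      refine integrandAddRel_subset_relations ⟨2, N, S, Q, hSd.trans hNd.symm, hQd.trans hNd.symm,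
        fun x hx => ?_, rfl⟩
      have hxS : x ∈ S.domain := by rw [hSd, ← hNd]; exact hx
      have hxQ : x ∈ Q.domain := by rw [hQd, ← hNd]; exact hx
      have hx' : ∀ i, x i ∈ Set.Ioo (0:ℝ) 1 := by rw [hNd] at hx; exact hx
      have ht : 1 - (x 0 * x 1) ^ 2 ≠ 0 := by
        have h0 := hx' 0; have h1 := hx' 1
        have hp : 0 < x 0 * x 1 := mul_pos h0.1 h1.1
        have hlt : x 0 * x 1 < 1 := by nlinarith [h0.1, h0.2, h1.1, h1.2]
        have hsq : (x 0 * x 1) ^ 2 < 1 := by nlinarith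
        exact (sub_pos.2 hsq).ne'
      rw [Pi.add_apply, hNi hx, hSi' hxS, hQi hxQ, hpQ]
      simp only [map_neg, map_mul, MvPolynomial.aeval_C, map_sum, map_pow, MvPolynomial.aeval_X,
        eq_ratCast]
      have e1 : x 0 ^ (2 * m + 1) * x 1 ^ (2 * m + 1) = (x 0 * x 1) * ((x 0 * x 1) ^ 2) ^ m := by ring
      have key := diag_identity (c * (x 0 * x 1)) ((x 0 * x 1) ^ 2) m ht
      rw [e1, ← Finset.mul_sum]
      calc (c : ℝ) * (x 0 * x 1 * ((x 0 * x 1) ^ 2) ^ m) / (1 - (x 0 * x 1) ^ 2)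
          = c * (x 0 * x 1) * ((x 0 * x 1) ^ 2) ^ m / (1 - (x 0 * x 1) ^ 2) := by ring
        _ = c * (x 0 * x 1) / (1 - (x 0 * x 1) ^ 2) +
              -(c * (x 0 * x 1) * ∑ i ∈ Finset.range m, ((x 0 * x 1) ^ 2) ^ i) := key
        _ = _ := by ring
    have hdil := diagOdd_levelTwo_sub_mem_relations c S B hSd hSi' hBd hBi
    have e : of N - of B - of Z = (of N - of S - of Q) + (of S - of B) + (of Q - of Z) := by abel
    rw [e]
    exact relations.add_mem (relations.add_mem hadd hdil) (hq Z hZd hZi)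

/-! ### The three carriers of the level-two normal form -/

/-- The level-two box carrier `[(0,1)², β/(1 − x₀²x₁²)]` exists. [cite: KontsevichZagier2001, §1.1] -/
theorem exists_levelTwoRep (β : ℚ) :
    ∃ B : IntegralRep 2, B.domain = {x | ∀ i, x i ∈ Set.Ioo (0:ℝ) 1} ∧
      EqOn B.integrand (fun x => (β : ℝ) / (1 - (x 0 * x 1) ^ 2)) B.domain := by
  obtain ⟨B, hBd, hBi⟩ := exists_levelNRep 2 (by norm_num) (MvPolynomial.C β)
  exact ⟨B, hBd, fun x _ => by rw [hBi]; simp⟩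

/-- Additivity of the level-two box carrier in `β` (rule 1b). [cite: KontsevichZagier2001, §1.2 rule (1)] -/
theorem levelTwoRep_add_mem_relations {β₁ β₂ : ℚ} (B B₁ B₂ : IntegralRep 2)
    (hBd : B.domain = {x | ∀ i, x i ∈ Set.Ioo (0:ℝ) 1})
    (hBi : EqOn B.integrand (fun x => ((β₁ + β₂ : ℚ) : ℝ) / (1 - (x 0 * x 1) ^ 2)) B.domain)
    (hB₁d : B₁.domain = {x | ∀ i, x i ∈ Set.Ioo (0:ℝ) 1})
    (hB₁i : EqOn B₁.integrand (fun x => (β₁ : ℝ) / (1 - (x 0 * x 1) ^ 2)) B₁.domain)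
    (hB₂d : B₂.domain = {x | ∀ i, x i ∈ Set.Ioo (0:ℝ) 1})
    (hB₂i : EqOn B₂.integrand (fun x => (β₂ : ℝ) / (1 - (x 0 * x 1) ^ 2)) B₂.domain) :
    of B - of B₁ - of B₂ ∈ relations := by
  refine integrandAddRel_subset_relations ⟨2, B, B₁, B₂, hB₁d.trans hBd.symm, hB₂d.trans hBd.symm,
    fun x hx => ?_, rfl⟩
  have hx₁ : x ∈ B₁.domain := by rw [hB₁d, ← hBd]; exact hx
  have hx₂ : x ∈ B₂.domain := by rw [hB₂d, ← hBd]; exact hx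
  rw [Pi.add_apply, hBi hx, hB₁i hx₁, hB₂i hx₂]
  push_cast
  ring

/-- The level-two box carrier with `β = 0` is a relation. [cite: KontsevichZagier2001, §1.2 rule (1)] -/
theorem levelTwoRep_zero_mem_relations (B : IntegralRep 2)
    (hBi : EqOn B.integrand (fun x => ((0 : ℚ) : ℝ) / (1 - (x 0 * x 1) ^ 2)) B.domain) :
    of B ∈ relations :=
  of_mem_relations_of_eqOn_zero B fun x hx => by rw [hBi hx]; simp

/-! ### The reduction at level two -/

/-- **Reduction to the level-two normal form** `β[(0,1)², 1/(1−x₀²x₁²)] + γ[(1,2), 1/y] + [pt, q]`: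
every `[(0,1)², P/(1 − x₀²x₁²)]`, `P ∈ ℚ[x₀,x₁]`, differs from it by Kontsevich–Zagier relations.
Induction on `P` (`diag_levelTwo`, `offDiag_levelTwo`, integrand additivity).
[cite: KontsevichZagier2001, §1.2] -/
theorem levelTwo_reduce (P : MvPolynomial (Fin 2) ℚ) :
    ∀ (N : IntegralRep 2), N.domain = {x | ∀ i, x i ∈ Set.Ioo (0:ℝ) 1} →
      EqOn N.integrand (fun x => (MvPolynomial.aeval x P : ℝ) / (1 - (x 0 * x 1) ^ 2)) N.domain →
      ∃ β γ q : ℚ, ∀ (B : IntegralRep 2) (L : IntegralRep 1) (Z : IntegralRep 0),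
        B.domain = {x | ∀ i, x i ∈ Set.Ioo (0:ℝ) 1} →
        EqOn B.integrand (fun x => (β : ℝ) / (1 - (x 0 * x 1) ^ 2)) B.domain →
        L.domain = {x | x 0 ∈ Set.Ioo (1:ℝ) 2} → EqOn L.integrand (fun x => (γ : ℝ) / x 0) L.domain →
        Z.domain = Set.univ → (Z.integrand = fun _ => (q : ℝ)) →
        of N - of B - of L - of Z ∈ relations := by
  induction P using MvPolynomial.induction_on' with
  | monomial s c =>
    intro N hNd hNi
    have hNi' : EqOn N.integrand (fun x => (c : ℝ) * (x 0 ^ (s 0) * x 1 ^ (s 1)) / (1 - (x 0 * x 1) ^ 2))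
        N.domain := fun x hx => by rw [hNi hx]; simp only [aeval_monomial_two]
    by_cases hs : s 0 = s 1
    · rw [hs] at hNi'
      obtain ⟨β, q, h⟩ := diag_levelTwo (s 1) c N hNd hNi'
      refine ⟨β, 0, q, fun B L Z hBd hBi hLd hLi hZd hZi => ?_⟩
      have e : of N - of B - of L - of Z = (of N - of B - of Z) - of L := by abel
      rw [e]
      exact relations.sub_mem (h B Z hBd hBi hZd hZi) (dlog_zero_mem_relations L hLi)
    · obtain ⟨γ, q, h⟩ := offDiag_levelTwo (s 0) (s 1) c hs N hNd hNi'
      refine ⟨0, γ, q, fun B L Z hBd hBi hLd hLi hZd hZi => ?_⟩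
      have e : of N - of B - of L - of Z = (of N - of L - of Z) - of B := by abel
      rw [e]
      exact relations.sub_mem (h L Z hLd hLi hZd hZi) (levelTwoRep_zero_mem_relations B hBi)
  | add P Q ihP ihQ =>
    intro N hNd hNi
    obtain ⟨NP, hNPd, hNPi⟩ := exists_levelNRep 2 (by norm_num) P
    obtain ⟨NQ, hNQd, hNQi⟩ := exists_levelNRep 2 (by norm_num) Q
    obtain ⟨β₁, γ₁, q₁, h₁⟩ := ihP NP hNPd (by rw [hNPi]; exact fun _ _ => rfl)
    obtain ⟨β₂, γ₂, q₂, h₂⟩ := ihQ NQ hNQd (by rw [hNQi]; exact fun _ _ => rfl)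
    refine ⟨β₁ + β₂, γ₁ + γ₂, q₁ + q₂, fun B L Z hBd hBi hLd hLi hZd hZi => ?_⟩
    have hsplit : of N - of NP - of NQ ∈ relations := by
      refine integrandAddRel_subset_relations ⟨2, N, NP, NQ, hNPd.trans hNd.symm,
        hNQd.trans hNd.symm, fun x hx => ?_, rfl⟩
      rw [Pi.add_apply, hNi hx, hNPi, hNQi]
      simp only [map_add]
      ring
    obtain ⟨B₁, hB₁d, hB₁i⟩ := exists_levelTwoRep β₁
    obtain ⟨B₂, hB₂d, hB₂i⟩ := exists_levelTwoRep β₂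
    obtain ⟨L₁, hL₁d, hL₁i⟩ := exists_dlog 1 2 γ₁ one_pos
    obtain ⟨L₂, hL₂d, hL₂i⟩ := exists_dlog 1 2 γ₂ one_pos
    obtain ⟨Zf, hZf⟩ := exists_ptCarrier
    have hL₁d' : L₁.domain = {x | x 0 ∈ Set.Ioo (1:ℝ) 2} := by rw [hL₁d]; push_cast; rfl
    have hL₂d' : L₂.domain = {x | x 0 ∈ Set.Ioo (1:ℝ) 2} := by rw [hL₂d]; push_cast; rfl
    have e₁ := h₁ B₁ L₁ (Zf q₁) hB₁d hB₁i hL₁d' (by rw [hL₁i]; exact fun _ _ => rfl) (hZf q₁).1 (hZf q₁).2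
    have e₂ := h₂ B₂ L₂ (Zf q₂) hB₂d hB₂i hL₂d' (by rw [hL₂i]; exact fun _ _ => rfl) (hZf q₂).1 (hZf q₂).2
    have eB := levelTwoRep_add_mem_relations B B₁ B₂ hBd hBi hB₁d hB₁i hB₂d hB₂i
    have eL := dlog_merge_mem_relations L L₁ L₂ hLd hL₁d' hL₂d' hLi
      (by rw [hL₁i]; exact fun _ _ => rfl) (by rw [hL₂i]; exact fun _ _ => rfl)
    have eZ := pt_add_mem_relations Z (Zf q₁) (Zf q₂) hZd (hZf q₁).1 (hZf q₂).1
      (by rw [hZi]; push_cast; rfl) (hZf q₁).2 (hZf q₂).2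
    have e : of N - of B - of L - of Z = (of N - of NP - of NQ) +
        (of NP - of B₁ - of L₁ - of (Zf q₁)) + (of NQ - of B₂ - of L₂ - of (Zf q₂)) -
        (of B - of B₁ - of B₂) - (of L - of L₁ - of L₂) - (of Z - of (Zf q₁) - of (Zf q₂)) := by abel
    rw [e]
    exact relations.sub_mem (relations.sub_mem (relations.sub_mem (relations.add_mem
      (relations.add_mem hsplit e₁) e₂) eB) eL) eZ

/-- **Values on the level-two family**: `N.value = β·π²/8 + γ·log 2 + q`.
[cite: KontsevichZagier2001, §1.1] -/
theorem levelTwo_value {N : IntegralRep 2} {β γ q : ℚ}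
    (h : ∀ (B : IntegralRep 2) (L : IntegralRep 1) (Z : IntegralRep 0),
        B.domain = {x | ∀ i, x i ∈ Set.Ioo (0:ℝ) 1} →
        EqOn B.integrand (fun x => (β : ℝ) / (1 - (x 0 * x 1) ^ 2)) B.domain →
        L.domain = {x | x 0 ∈ Set.Ioo (1:ℝ) 2} → EqOn L.integrand (fun x => (γ : ℝ) / x 0) L.domain →
        Z.domain = Set.univ → (Z.integrand = fun _ => (q : ℝ)) →
        of N - of B - of L - of Z ∈ relations) :
    N.value = (β : ℝ) * (Real.pi ^ 2 / 8) + (γ : ℝ) * Real.log 2 + q := by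
  obtain ⟨B, hBd, hBi⟩ := exists_levelTwoRep β
  obtain ⟨L, hLd, hLi⟩ := exists_dlog 1 2 γ one_pos
  obtain ⟨Zf, hZf⟩ := exists_ptCarrier
  have hLd' : L.domain = {x | x 0 ∈ Set.Ioo (1:ℝ) 2} := by rw [hLd]; push_cast; rfl
  have hLi' : EqOn L.integrand (fun x => (γ : ℝ) / x 0) L.domain := by rw [hLi]; exact fun _ _ => rfl
  have h0 := relations_le_ker_eval_holds (h B L (Zf q) hBd hBi hLd' hLi' (hZf q).1 (hZf q).2)
  have hvL := value_dlog L hLd hLi' one_pos (by norm_num)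
  rw [AddMonoidHom.mem_ker, map_sub, map_sub, map_sub, eval_of, eval_of, eval_of, eval_of,
    value_levelTwoRep β B hBd hBi, hvL, value_pt (Zf q) (hZf q).1 (hZf q).2] at h0
  push_cast at h0
  rw [div_one] at h0
  linarith

end Summit.KontsevichZagierPeriods.HurwitzMicroSectors.NormalFormPrinciple.PiBox.LevelN
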